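import HarnessLib

set_option autoImplicit false

/-!
# Rank-≤ 1 residual PARTITION, part 1/3 — the finite GRID and ENGINE 2 (`decide`)

HONEST FRAMING (cell `b2b-bsdres`): prove what is provable now; shrink each hard class to its
core with data; no claim beyond stated classes. These three files claim NO case of the BSD
formula; they prove a CLASSIFICATION: every pair `(E, p)` (`E/ℚ` of analytic rank `≤ 1`, `p`
prime) is covered by the printed hypotheses of a cited theorem of RESIDUAL-CASES §a.1, or lies in
one of the residual classes X1–X12 exactly as typed in `Rank1Residual/Predicates.lean`, or lies in
ONE region that is in no covering row and no Lean class (the former C4 domain, said loudly in part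
3), given Serre's open-image lemma as an explicit hypothesis (part 3).

This part is self-contained finite combinatorics. A `Cell` records thirteen atoms of a pair: rank
`r0 | r1`; `p = 2 | p = 3 | p ≥ 5`; reduction type at `p` (`ord`, `ss` = good non-ordinary,
`mult`, `add`); `irr(p)`, `surj(p)`, (im); CM or not and the type of `p` in the CM field
(`split | inert | ram`, junk for non-CM); `sst`, `ram(p)`, `anom(p)`, `gvpar(p)`, `a_3 = 0` —
`36 864` cells. `spec : Target → Cell → Bool` is the defining predicate of each of the 31 targets
(6 empty-by-a-tree-theorem configurations; covering rows C8 C17 C9 C10 / C1 C2 C16 C3 C6 C7 =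
the printed hypotheses of Burungale–Flach 2024, Li–Liu–Tian 2024, Rubin 1991, Kobayashi 2013,
Skinner 2016, Burungale–Castella–Skinner 2025, Yan–Zhu 2026, Jetchev–Skinner–Wan 2017,
Castella–Grossi–Skinner 2025, Greenberg–Vatsal 2000 + Kato + Greenberg; the classes X1–X12 = the
atoms of `ClassX1 … ClassX12`; `newFormerC4`; `emptyLitSerre`; `gap`). `classify` sends a cell to
the FIRST target of `targetOrder` it meets (CM rows and X12 first, then `p = 2`, then the non-CM
rows, then the classes with X8 before X7). ENGINE 2 = `gridCheck_all` (six kernel `decide`s of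
6 144 cells): the classifier meets its spec, no cell is `gap`, a CM cell only reaches CM-allowed
targets, `newFormerC4` ⇔ the former-C4 configuration, `emptyLitSerre` ⇒ the Serre configuration.
ENGINE 1 (Python, same atoms, same order, with counts: 27 264 empty + 4 184 covered + 5 344 class
+ 24 new + 48 Serre + 0 gap) and the referee acceptance test: HOME/PARTITION.md
(run/shared/lean/b2b/bsd-rank1-residual/; hyp seat gen 5). Part 2 binds the grid to curves
(`cellOf`, `holds_of_spec`); part 3 states the partition theorems.
-/

namespace Summit.BirchSwinnertonDyer.BirchSwinnertonDyer.Rank1Residual.Partition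

/-! ## Layer 1: the grid -/

/-- Analytic rank atom: `r_an = 0` or `r_an = 1`. -/
inductive Rk | r0 | r1
  deriving DecidableEq, Repr

/-- Prime atom: `p = 2`, `p = 3`, `p ≥ 5`. -/
inductive PC | p2 | p3 | p5
  deriving DecidableEq, Repr

/-- Reduction type of `E` at `p`: good ordinary, good supersingular, multiplicative, additive. -/
inductive Rt | ord | ss | mult | add
  deriving DecidableEq, Repr

/-- Behaviour of `p` in the CM field `K` (read off `j`; junk for a non-CM curve): split / inert /
ramified. -/
inductive PK | split | inert | ram
  deriving DecidableEq, Repr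

/-- A grid cell: the thirteen atoms of a pair `(E, p)`. -/
structure Cell where
  r : Rk
  pc : PC
  red : Rt
  irr : Bool
  surj : Bool
  im : Bool
  cm : Bool
  pK : PK
  sst : Bool
  ram : Bool
  anom : Bool
  gvpar : Bool
  a3z : Bool
  deriving DecidableEq, Repr

/-- The targets of the classification, in the order they are tried (see `targetOrder`). -/
inductive Target
  | emptyAnom | emptySstAdd | emptySurjRed | emptySmallIm | emptySsRed | emptySstIrrNonsurj
  | C8 | C17 | C9 | C10 | X12 | X5
  | C1 | C2 | C16 | C3 | C6 | C7
  | X3 | X4 | X2 | X1 | X8 | X7 | X6 | X9 | X10 | X11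
  | newFormerC4
  | emptyLitSerre
  | gap
  deriving DecidableEq, Repr

namespace Rk
/-- `r = 0`. -/
def is0 : Rk → Bool | r0 => true | r1 => false
/-- `r = 1`. -/
def is1 : Rk → Bool | r0 => false | r1 => true
end Rk

namespace PC
/-- `p = 2`. -/
def is2 : PC → Bool | p2 => true | _ => false
/-- `p = 3`. -/
def is3 : PC → Bool | p3 => true | _ => false
/-- `p ≥ 5`. -/
def is5 : PC → Bool | p5 => true | _ => false
/-- `p` odd. -/
def odd : PC → Bool | p2 => false | _ => true
end PC

namespace Rt
/-- good ordinary. -/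
def isOrd : Rt → Bool | ord => true | _ => false
/-- good supersingular. -/
def isSS : Rt → Bool | ss => true | _ => false
/-- multiplicative. -/
def isMult : Rt → Bool | mult => true | _ => false
/-- additive. -/
def isAdd : Rt → Bool | add => true | _ => false
/-- good. -/
def isGood : Rt → Bool | ord => true | ss => true | _ => false
end Rt

namespace PK
/-- split. -/
def isSplit : PK → Bool | split => true | _ => false
/-- inert. -/
def isInert : PK → Bool | inert => true | _ => false
/-- ramified. -/
def isRam : PK → Bool | ram => true | _ => false
end PK

/-- The defining Boolean predicate of each target on the grid (engine 1's lambdas, verbatim). -/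
def spec : Target → Cell → Bool
  -- empty by a theorem in the tree
  | .emptyAnom, c => c.anom && (c.irr || !c.red.isOrd)
  | .emptySstAdd, c => c.sst && c.red.isAdd
  | .emptySurjRed, c => c.surj && !c.irr
  | .emptySmallIm, c => c.irr && !c.surj && c.im
  | .emptySsRed, c => c.red.isSS && !c.irr && c.pc.odd
  | .emptySstIrrNonsurj, c => c.sst && c.irr && !c.surj
  -- CM: covering rows C8, C17, C9, C10 of RESIDUAL-CASES §a.1 (printed hypotheses), then class X12
  | .C8, c => c.cm && c.r.is0
  | .C17, c => c.cm && c.r.is1 && c.pc.odd && c.pK.isSplit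
  | .C9, c => c.cm && c.r.is1 && c.pc.odd && c.pK.isSplit && c.red.isGood
  | .C10, c => c.cm && c.r.is1 && c.pc.odd && c.pK.isInert && c.red.isGood
  | .X12, c => c.cm && c.r.is1 &&
      (c.pc.is2 || (c.pc.is3 && !c.pK.isSplit) || c.pK.isRam || !c.red.isGood)
  -- p = 2
  | .X5, c => c.pc.is2
  -- non-CM covering rows of RESIDUAL-CASES §a.1: printed hypotheses of the cited theorem
  | .C1, c => c.r.is0 && c.pc.odd && (c.red.isOrd || c.red.isMult) && c.irr && c.ram
  | .C2, c => !c.cm && c.pc.is5 && c.red.isOrd && c.irr && c.im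
  | .C16, c => !c.cm && c.pc.odd && c.red.isOrd && c.irr && c.im
  | .C3, c => c.r.is1 && c.sst && c.red.isGood && c.irr &&
      (c.pc.is5 || (c.pc.is3 && (c.red.isOrd || c.a3z)))
  | .C6, c => c.pc.odd && !c.irr && c.red.isGood && !c.anom
  | .C7, c => c.r.is0 && !c.cm && c.pc.odd && c.red.isOrd && !c.irr && c.gvpar
  -- residual classes, EXACT predicates of Rank1Residual/Predicates.lean
  | .X3, c => !c.irr && c.red.isAdd
  | .X4, c => c.pc.odd && c.red.isAdd && c.irr
  | .X2, c => c.pc.odd && !c.irr && c.red.isMult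
  | .X1, c => c.pc.odd && !c.irr && c.red.isGood && c.anom && !(c.r.is0 && c.gvpar)
  | .X8, c => c.pc.is3 && c.red.isSS && !c.a3z
  | .X7, c => c.red.isSS && !c.sst
  | .X6, c => c.red.isSS && c.sst && (c.pc.is5 || c.a3z)
  | .X9, c => !c.cm && c.red.isOrd && c.pc.is5 && c.irr && !c.surj && (c.r.is0 || !c.sst)
  | .X10, c => c.pc.is3 && c.red.isOrd && c.irr && ((c.r.is0 && !c.ram) || (c.r.is1 && !c.sst))
  | .X11, c => c.red.isMult && c.irr && (!c.ram || (c.r.is1 && !c.sst) || (c.r.is1 && c.pc.is3))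
  -- the former C4 domain (LOUD: in RESIDUAL-CASES X11b, outside the Lean ClassX11)
  | .newFormerC4, c => c.r.is1 && c.red.isMult && c.irr && c.sst && c.ram && c.pc.is5
  -- empty by Serre (published, not in the tree)
  | .emptyLitSerre, c => c.surj && c.pc.is5 && !c.im
  | .gap, _ => false

/-- The ordered list of targets tried by `classify` (first match wins): tree-empty; CM decided
first (C8, C17, C9, C10, X12); `p = 2`; the non-CM covering rows; the classes (X8 before X7); the
new region; Serre-empty. -/
def targetOrder : List Target :=
  [.emptyAnom, .emptySstAdd, .emptySurjRed, .emptySmallIm, .emptySsRed, .emptySstIrrNonsurj,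
   .C8, .C17, .C9, .C10, .X12, .X5,
   .C1, .C2, .C16, .C3, .C6, .C7,
   .X3, .X4, .X2, .X1, .X8, .X7, .X6, .X9, .X10, .X11,
   .newFormerC4, .emptyLitSerre]

/-- First target of a list whose `spec` holds on the cell, else `gap`. -/
def firstMatch (c : Cell) : List Target → Target
  | [] => .gap
  | t :: ts => if spec t c then t else firstMatch c ts

/-- The classification function of the grid. -/
def classify (c : Cell) : Target := firstMatch c targetOrder

/-- The targets a CM cell may reach: empty-by-tree, the CM covering rows C8 / C17 / C9 / C10, and
X12. -/
def Target.cmAllowed : Target → Bool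
  | .emptyAnom | .emptySstAdd | .emptySurjRed | .emptySmallIm | .emptySsRed | .emptySstIrrNonsurj
  | .C8 | .C17 | .C9 | .C10 | .X12 => true
  | _ => false

/-! ### Boolean enumeration of the grid (kernel-friendly: no `Fintype`, no `Decidable (∀ …)` chains) -/

/-- `f` holds at both ranks. -/
def Rk.all (f : Rk → Bool) : Bool := f .r0 && f .r1
/-- `f` holds at the three prime atoms. -/
def PC.all (f : PC → Bool) : Bool := f .p2 && f .p3 && f .p5
/-- `f` holds at the four reduction types. -/
def Rt.all (f : Rt → Bool) : Bool := f .ord && f .ss && f .mult && f .add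
/-- `f` holds at the three CM-prime behaviours. -/
def PK.all (f : PK → Bool) : Bool := f .split && f .inert && f .ram
/-- `f` holds at both Booleans. -/
def ball (f : Bool → Bool) : Bool := f false && f true

/-- Unfolding of `Rk.all`. -/
theorem Rk.all_iff (f : Rk → Bool) : Rk.all f = true ↔ ∀ x, f x = true := by
  simp only [Rk.all, Bool.and_eq_true]
  exact ⟨fun h x => by rcases h with ⟨h0, h1⟩; cases x <;> assumption, fun h => ⟨h _, h _⟩⟩

/-- Unfolding of `PC.all`. -/
theorem PC.all_iff (f : PC → Bool) : PC.all f = true ↔ ∀ x, f x = true := by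
  simp only [PC.all, Bool.and_eq_true, and_assoc]
  exact ⟨fun h x => by rcases h with ⟨h0, h1, h2⟩; cases x <;> assumption,
    fun h => ⟨h _, h _, h _⟩⟩

/-- Unfolding of `Rt.all`. -/
theorem Rt.all_iff (f : Rt → Bool) : Rt.all f = true ↔ ∀ x, f x = true := by
  simp only [Rt.all, Bool.and_eq_true, and_assoc]
  exact ⟨fun h x => by rcases h with ⟨h0, h1, h2, h3⟩; cases x <;> assumption,
    fun h => ⟨h _, h _, h _, h _⟩⟩

/-- Unfolding of `PK.all`. -/
theorem PK.all_iff (f : PK → Bool) : PK.all f = true ↔ ∀ x, f x = true := by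
  simp only [PK.all, Bool.and_eq_true, and_assoc]
  exact ⟨fun h x => by rcases h with ⟨h0, h1, h2⟩; cases x <;> assumption,
    fun h => ⟨h _, h _, h _⟩⟩

/-- Unfolding of `ball`. -/
theorem ball_iff (f : Bool → Bool) : ball f = true ↔ ∀ x, f x = true := by
  simp only [ball, Bool.and_eq_true]
  exact ⟨fun h x => by rcases h with ⟨h0, h1⟩; cases x <;> assumption, fun h => ⟨h _, h _⟩⟩

/-- `f` holds on the `6 144` cells with given rank and prime atoms (nested Boolean conjunction). -/
def Cell.allRP (r : Rk) (pc : PC) (f : Cell → Bool) : Bool :=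
  Rt.all fun red => ball fun irr => ball fun surj => ball fun im => ball fun cm =>
    PK.all fun pK => ball fun sst => ball fun ram => ball fun anom => ball fun gvpar =>
      ball fun a3z => f ⟨r, pc, red, irr, surj, im, cm, pK, sst, ram, anom, gvpar, a3z⟩

/-- `f` holds on all `36 864` cells. -/
def Cell.all (f : Cell → Bool) : Bool :=
  Rk.all fun r => PC.all fun pc => Cell.allRP r pc f

/-- A Boolean fold over the whole grid that returns `true` holds at every cell. -/
theorem Cell.forall_of_all (f : Cell → Bool) (h : Cell.all f = true) : ∀ c, f c = true := by
  rintro ⟨r, pc, red, irr, surj, im, cm, pK, sst, ram, anom, gvpar, a3z⟩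
  simp only [Cell.all, Cell.allRP, Rk.all_iff, PC.all_iff, Rt.all_iff, PK.all_iff, ball_iff] at h
  exact h r pc red irr surj im cm pK sst ram anom gvpar a3z

/-! ### Engine 2: the grid facts, evaluated ONCE by the kernel (`decide +kernel` on a closed Boolean) -/

/-- Test for the new-region target. -/
def Target.isNew : Target → Bool | .newFormerC4 => true | _ => false

/-- Test for the Serre target. -/
def Target.isSerre : Target → Bool | .emptyLitSerre => true | _ => false

/-- `isNew` singles out `newFormerC4`. -/
theorem Target.isNew_iff (t : Target) : t.isNew = true ↔ t = .newFormerC4 := by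
  cases t <;> simp [Target.isNew]

/-- The live former-C4 configuration on the grid. -/
def Cell.formerC4Cfg (c : Cell) : Bool :=
  c.r.is1 && c.red.isMult && c.irr && c.sst && c.ram && c.pc.is5 && !c.cm && !c.anom && c.surj

/-- The Serre configuration on the grid. -/
def Cell.serreCfg (c : Cell) : Bool :=
  !c.cm && c.red.isOrd && c.pc.is5 && c.irr && c.surj && !c.im &&
    ((c.r.is0 && !c.ram) || (c.r.is1 && !c.sst))

/-- The four grid facts checked per cell: the classifier meets its spec; a CM cell reaches only a
CM-allowed target; the new region is exactly the former-C4 configuration; the Serre target only in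
the Serre configuration. -/
def gridCheck (c : Cell) : Bool :=
  let t := classify c
  spec t c && (!c.cm || t.cmAllowed) && (t.isNew == c.formerC4Cfg) && (!t.isSerre || c.serreCfg)

/-! **ENGINE 2.** All `36 864` cells pass `gridCheck`: six kernel evaluations of `6 144` cells
each (one per rank × prime atom, each comfortably inside the default kernel budget), assembled by
`gridCheck_all`. Engine 1 (`partition_enum.py`, same atoms, same order) prints the same partition
with counts (HOME/b2b-bsdres-hyp/partition/PARTITION.md). -/

/-- Engine 2, chunk `r0 / p = 2` (6 144 cells, kernel `decide`). -/
theorem gridCheck_r0_p2 : Cell.allRP .r0 .p2 gridCheck = true := by decide +kernel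
/-- Engine 2, chunk `r0 / p = 3` (6 144 cells, kernel `decide`). -/
theorem gridCheck_r0_p3 : Cell.allRP .r0 .p3 gridCheck = true := by decide +kernel
/-- Engine 2, chunk `r0 / p ≥ 5` (6 144 cells, kernel `decide`). -/
theorem gridCheck_r0_p5 : Cell.allRP .r0 .p5 gridCheck = true := by decide +kernel
/-- Engine 2, chunk `r1 / p = 2` (6 144 cells, kernel `decide`). -/
theorem gridCheck_r1_p2 : Cell.allRP .r1 .p2 gridCheck = true := by decide +kernel
/-- Engine 2, chunk `r1 / p = 3` (6 144 cells, kernel `decide`). -/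
theorem gridCheck_r1_p3 : Cell.allRP .r1 .p3 gridCheck = true := by decide +kernel
/-- Engine 2, chunk `r1 / p ≥ 5` (6 144 cells, kernel `decide`). -/
theorem gridCheck_r1_p5 : Cell.allRP .r1 .p5 gridCheck = true := by decide +kernel

/-- Engine 2: all 36 864 cells pass `gridCheck` (the six chunks assembled). -/
theorem gridCheck_all : Cell.all gridCheck = true := by
  simp only [Cell.all, Rk.all, PC.all, gridCheck_r0_p2, gridCheck_r0_p3, gridCheck_r0_p5,
    gridCheck_r1_p2, gridCheck_r1_p3, gridCheck_r1_p5, Bool.and_self]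

/-- Every cell passes `gridCheck`. -/
theorem gridCheck_true (c : Cell) : gridCheck c = true :=
  Cell.forall_of_all _ gridCheck_all c

/-- **Soundness of the classifier**: the target returned by `classify` satisfies its own defining
predicate on the cell. Together with `spec .gap _ = false` this is the grid partition. -/
theorem spec_classify (c : Cell) : spec (classify c) c = true := by
  have h := gridCheck_true c
  simp only [gridCheck, Bool.and_eq_true] at h
  exact h.1.1.1

/-- **No grid cell is unaccounted for.** -/
theorem classify_ne_gap (c : Cell) : classify c ≠ .gap := by
  intro h
  have := spec_classify c
  rw [h] at this
  exact Bool.false_ne_true this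

/-- **CM is decided before every supersingular / small-image / non-CM test** (acceptance point 7):
a CM cell is empty or goes to C8 (r = 0), C17 / C9 / C10 (r = 1, p odd, split / inert-good) or X12
— never to X5, X6, X7, X8 (nor X1–X4, X9–X11, the new region, the non-CM covering rows). -/
theorem classify_cm (c : Cell) (hc : c.cm = true) : (classify c).cmAllowed = true := by
  have h := gridCheck_true c
  simp only [gridCheck, Bool.and_eq_true] at h
  simpa [hc] using h.1.1.2

/-- **The NEW region, said loudly**: `classify` sends a cell to `newFormerC4` iff it lies in the
former C4 domain `r = 1 ∧ mult ∧ irr ∧ sst ∧ ram ∧ p ≥ 5`, non-CM, non-anomalous, with `surj`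
(forced on a live cell by sst ∧ irr) — 24 cells ((im), `pK`, `gvpar`, `a_3 = 0` free): in no
covering row and in no Lean class. -/
theorem classify_eq_newFormerC4_iff (c : Cell) :
    classify c = .newFormerC4 ↔ c.formerC4Cfg = true := by
  have h := gridCheck_true c
  simp only [gridCheck, Bool.and_eq_true] at h
  have h' := h.1.2
  rw [beq_iff_eq] at h'
  rw [← Target.isNew_iff, h']

/-- **The Serre region, said loudly**: a cell is empty-by-Serre only in the configuration
`¬cm ∧ ord ∧ p ≥ 5 ∧ irr ∧ surj ∧ ¬(im)` with `r = 0 ∧ ¬ram` or `r = 1 ∧ ¬sst` (48 cells). -/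
theorem serreCfg_of_classify_eq (c : Cell) (h : classify c = .emptyLitSerre) :
    c.serreCfg = true := by
  have h' := gridCheck_true c
  simp only [gridCheck, Bool.and_eq_true] at h'
  have h'' := h'.2
  rw [h] at h''
  simpa [Target.isSerre] using h''

end Summit.BirchSwinnertonDyer.BirchSwinnertonDyer.Rank1Residual.Partition
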